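/-
Origin: written from primary sources — S. Kudla, *Seesaw dual reductive pairs* (1984) §1 (the see-saw pair
`(U(V₁) × U(V₂), U(W) × U(W)) ↔ (U(V₁ ⊕ V₂), U(W))` in `Sp(Res((V₁ ⊕ V₂) ⊗ W))`); R. Howe, *θ-series and invariant theory*
(1979) §2–§3; S. Gelbart, J. Rogawski, Invent. Math. 105 (1991) §3.1 Prop. 3.1.1 p. 455 and Remark p. 457 (compatible
splittings differ by a character trivial on rational points); A. Weil, Acta Math. 111 (1964) Chap. III n° 41 Thm 6 p. 193;
Y. Liu, Camb. J. Math. 9 (2021) proof of Thm. 4.15 (arXiv:2102.11518 `FJcycle.tex` l. 2193–2210: restriction of theta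
functions along `U(V⋆) × U(V⋆^⊥) ↪ U(V)`). Adapted: no. This file is the MIRROR of `UnitaryDualPairSeesawCharacter` with the
FIRST member of the dual pair split instead of the second: the junction, at the splitting data OF RECORD
(`UnitaryDualPairSplittingDatum`, `UnitaryDualPairThetaKernel`) of the three dual pairs `(U(J₁ ⊕ᶠ J₂), U(J_W))`,
`(U(J₁), U(J_W))`, `(U(J₂), U(J_W))`, of the abstract see-saw character (`Weil1964/AdelicMetaplecticSeesawSum`) with the
V-side adelic see-saw square (`UnitaryGroupDirectSumCarriersLeft.adelicPairToSymplectic_adelicBlockDiag_dualPair`); `finSum_eq_map_finSum` and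
`isUnit_kronecker_map` are reused from `UnitaryDualPairSeesawCharacter`. Kernel only; no records; the compatibility of the three splittings ([GelbartRogawski1991, Prop. 3.1.1]) is a hypothesis, never
asserted.
-/
import Literature.NumberTheory.GelbartRogawski1991.UnitaryDualPairSeesawCharacter
import Literature.NumberTheory.Automorphic.UnitaryGroupDirectSumCarriersLeft
import Literature.NumberTheory.Weil1964.AdelicMetaplecticSeesawSum
import HarnessLib

/-!
# The V-side see-saw character of the unitary dual pairs `(U(V₁ ⊕ V₂), U(W))`, `(U(V_j), U(W))` at the splitting data
# of record — [Liu 2021]'s restriction `U(V⋆) × U(V⋆^⊥) ↪ U(V)` of the Weil representation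

Setting (`UnitaryDualPairSplittingDatum`): a quadratic extension `E/F` of number fields, `c ∈ Gal(E/F)`, `δ ∈ E` with
`c δ = -δ`, `δ² = d ∈ F`; hermitian Gram matrices `J_j = T_j ⊗ 1` of the two summands of `V = V₁ ⊕ V₂` (`T_j ∈ GL_{N_j}(F)`
symmetric), `V` itself carried by `Fin (N₁ + N₂)` with Gram `J₁ ⊕ᶠ J₂ = (T₁ ⊕ᶠ T₂) ⊗ 1`, and ONE space `W` with Gram
`J_W = T_W ⊗ 1` (`T_W ∈ GL_M(F)` symmetric); enumerations `e_V : Fin (N₁ + N₂) × Fin M ≃ Fin n`, `e_j : Fin N_j × Fin M ≃ Fin n_j`;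
and three homomorphisms `s, s₁, s₂` into the metaplectic groups of record of `Res(V ⊗ W)`, `Res(V_j ⊗ W)` which are
COMPATIBLE in the sense of [GelbartRogawski1991, Prop. 3.1.1] (hypotheses `hs`, `hs₁`, `hs₂ : (splittingDatum …).IsCompatible _`).

* §1 the three pair splittings read on the see-saw group `P = (U(J₁)(𝔸) × U(J₂)(𝔸)) × U(J_W)(𝔸)` in KRONECKER
  coordinates: `seesawBigLeft s : P →* Mp_ψ(W_{(T₁ ⊕ᶠ T₂) ⊗ T_W})ᶜᵒⁿᵗ` (`((g₁, g₂), u) ↦ s_pair(g₁ ⊕ᶠ g₂, u)` read back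
  along `e_V`), `seesawSmallLeft₁ s₁`, `seesawSmallLeft₂ s₂` (`((g₁, g₂), u) ↦ s_{j,pair}(g_j, u)` read back along `e_j`);
  their projections are unitary-2's `adelicPairToSymplectic … (dualPair (·, u))` (`proj_seesawBigLeft`,
  `proj_seesawSmallLeft₁/₂`), their values at rational points are `Θ`-fixing (`coe_seesawBigLeft_mem_adelicMpTheta`, …),
  and their Weil operators are those of `s_pair` up to `R_{e}` (`omega_seesawBigLeft_apply`, …);
* §2 **`hS_seesawLeft`**: the hypothesis `hS` of `mpSeesawCharSum` along
  `e_Σ := (finSumFinEquiv × 1)⁻¹ ≫ Equiv.sumProdDistrib` holds — it IS `adelicPairToSymplectic_adelicBlockDiag_dualPair` —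
  whence **`mpSeesawCharLeft … s s₁ s₂ hs hs₁ hs₂ : P →* ℂˣ`** with
  `ω(seesawBigLeft s p) (sumTensor Φ₁ Φ₂) = χ(p) • sumTensor (ω(seesawSmallLeft₁ s₁ p) Φ₁) (ω(seesawSmallLeft₂ s₂ p) Φ₂)`
  (`mpSeesawCharLeft_spec`), **`χ = 1` on `(U(J₁)(F) × U(J₂)(F)) × U(J_W)(F)`** (`mpSeesawCharLeft_eq_one_of_rational`:
  [GelbartRogawski1991, Remark p. 457] in kernel form), and `mpSeesawCharLeft_def` so that the scheme identities of
  `AdelicMetaplecticSeesawCharacter` apply verbatim; §3 the THETA form: `Θ(ω(seesawBigLeft s p) (sumTensor Φ₁ Φ₂)) =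
  χ(p) · Θ(ω(seesawSmallLeft₁ s₁ p) Φ₁) · Θ(ω(seesawSmallLeft₂ s₂ p) Φ₂)` (`thetaDistLM_omega_seesawBigLeft_sumTensor`) —
  [Liu2021]'s «claim» (l. 2199–2210) at the level of Weil's theta functional, for pure tensors.

What this file does NOT do: identify `χ` beyond its automorphy (that is the (T2) S2c stub: for Liu's `ω_{μ,ε}` normalisation
the characters are restrictions of the `μ`-twist), the test-vector decomposition (S2d), and the passage to forms/classes (S2e).
-/

set_option autoImplicit false

noncomputable section

open scoped Matrix Kronecker
open NumberField
open Literature.RepresentationTheory.HeisenbergGroup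
open Literature.NumberTheory.Automorphic
open Literature.NumberTheory.Automorphic.UnitaryGroup
open Literature.NumberTheory.Weil1964


namespace Literature.NumberTheory.GelbartRogawski1991

namespace UnitaryDualPair

section Homs

variable (F E : Type) [Field F] [NumberField F] [Field E] [NumberField E] [Algebra F E]
variable (c : E ≃ₐ[F] E) (N₁ N₂ M : ℕ) {n n₁ n₂ : ℕ}
  (eV : Fin (N₁ + N₂) × Fin M ≃ Fin n) (e₁ : Fin N₁ × Fin M ≃ Fin n₁) (e₂ : Fin N₂ × Fin M ≃ Fin n₂)
variable (J₁ : Matrix (Fin N₁) (Fin N₁) E) (J₂ : Matrix (Fin N₂) (Fin N₂) E) (JW : Matrix (Fin M) (Fin M) E)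
variable {T₁ : Matrix (Fin N₁) (Fin N₁) F} {T₂ : Matrix (Fin N₂) (Fin N₂) F} {TW : Matrix (Fin M) (Fin M) F}

/-- **The big pair splitting on the V-side see-saw group, Kronecker coordinates**:
`((g₁, g₂), u) ↦ reindex_{e_V}⁻¹ (s_pair(g₁ ⊕ᶠ g₂, u)) ∈ Mp_ψ(W_{(T₁ ⊕ᶠ T₂) ⊗ T_W})ᶜᵒⁿᵗ`. (cf. S. Kudla (1984) §1;
[Liu2021] proof of Thm. 4.15, l. 2193) [folklore] -/
def seesawBigLeft (s : adelicPair F E c (N₁ + N₂) M (finSum N₁ N₂ J₁ J₂) JW →*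
      adelicMpCont F (Fin n) (adelicGram F eV (finSum N₁ N₂ T₁ T₂) TW)) :
    (adelic F E c N₁ J₁ × adelic F E c N₂ J₂) × adelic F E c M JW →*
      adelicMpCont F (Fin (N₁ + N₂) × Fin M)
        ((finSum N₁ N₂ T₁ T₂).map (algebraMap F (AdeleRing (𝓞 F) F)) ⊗ₖ TW.map (algebraMap F (AdeleRing (𝓞 F) F))) :=
  ((adelicMpContReindex F eV
      ((finSum N₁ N₂ T₁ T₂).map (algebraMap F (AdeleRing (𝓞 F) F)) ⊗ₖ
        TW.map (algebraMap F (AdeleRing (𝓞 F) F)))).symm.toMonoidHom.comp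
    (pairSplitting F E c (N₁ + N₂) M eV (finSum N₁ N₂ J₁ J₂) JW s)).comp
    ((adelicBlockDiag F E c N₁ N₂ J₁ J₂).prodMap (MonoidHom.id (adelic F E c M JW)))

/-- Unfolding: the see-saw restriction `((g₁,g₂),u) ↦ s_pair(g₁ ⊕ᶠ g₂, u)` read back along `e_V`. [cite: Kudla1984, §1] -/
theorem seesawBigLeft_apply (s : adelicPair F E c (N₁ + N₂) M (finSum N₁ N₂ J₁ J₂) JW →*
      adelicMpCont F (Fin n) (adelicGram F eV (finSum N₁ N₂ T₁ T₂) TW))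
    (p : (adelic F E c N₁ J₁ × adelic F E c N₂ J₂) × adelic F E c M JW) :
    seesawBigLeft F E c N₁ N₂ M eV J₁ J₂ JW s p =
      (adelicMpContReindex F eV
        ((finSum N₁ N₂ T₁ T₂).map (algebraMap F (AdeleRing (𝓞 F) F)) ⊗ₖ
          TW.map (algebraMap F (AdeleRing (𝓞 F) F)))).symm
        (pairSplitting F E c (N₁ + N₂) M eV (finSum N₁ N₂ J₁ J₂) JW s (adelicBlockDiag F E c N₁ N₂ J₁ J₂ p.1, p.2)) :=
  rfl

/-- **The first small pair splitting on the V-side see-saw group, Kronecker coordinates**: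
`((g₁, g₂), u) ↦ reindex_{e₁}⁻¹ (s_{1,pair}(g₁, u))`. [folklore] -/
def seesawSmallLeft₁ (s₁ : adelicPair F E c N₁ M J₁ JW →* adelicMpCont F (Fin n₁) (adelicGram F e₁ T₁ TW)) :
    (adelic F E c N₁ J₁ × adelic F E c N₂ J₂) × adelic F E c M JW →*
      adelicMpCont F (Fin N₁ × Fin M)
        (T₁.map (algebraMap F (AdeleRing (𝓞 F) F)) ⊗ₖ TW.map (algebraMap F (AdeleRing (𝓞 F) F))) :=
  ((adelicMpContReindex F e₁
      (T₁.map (algebraMap F (AdeleRing (𝓞 F) F)) ⊗ₖ TW.map (algebraMap F (AdeleRing (𝓞 F) F)))).symm.toMonoidHom.comp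
    (pairSplitting F E c N₁ M e₁ J₁ JW s₁)).comp
    (((MonoidHom.fst (adelic F E c N₁ J₁) (adelic F E c N₂ J₂)).comp
        (MonoidHom.fst (adelic F E c N₁ J₁ × adelic F E c N₂ J₂) (adelic F E c M JW))).prod
      (MonoidHom.snd (adelic F E c N₁ J₁ × adelic F E c N₂ J₂) (adelic F E c M JW)))

/-- Unfolding: `((g₁,g₂),u) ↦ s_{1,pair}(g₁, u)` read back along `e₁`. [cite: Kudla1984, §1] -/
theorem seesawSmallLeft₁_apply (s₁ : adelicPair F E c N₁ M J₁ JW →* adelicMpCont F (Fin n₁) (adelicGram F e₁ T₁ TW))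
    (p : (adelic F E c N₁ J₁ × adelic F E c N₂ J₂) × adelic F E c M JW) :
    seesawSmallLeft₁ F E c N₁ N₂ M e₁ J₁ J₂ JW s₁ p =
      (adelicMpContReindex F e₁
        (T₁.map (algebraMap F (AdeleRing (𝓞 F) F)) ⊗ₖ TW.map (algebraMap F (AdeleRing (𝓞 F) F)))).symm
        (pairSplitting F E c N₁ M e₁ J₁ JW s₁ (p.1.1, p.2)) :=
  rfl

/-- **The second small pair splitting on the V-side see-saw group, Kronecker coordinates**:
`((g₁, g₂), u) ↦ reindex_{e₂}⁻¹ (s_{2,pair}(g₂, u))`. [folklore] -/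
def seesawSmallLeft₂ (s₂ : adelicPair F E c N₂ M J₂ JW →* adelicMpCont F (Fin n₂) (adelicGram F e₂ T₂ TW)) :
    (adelic F E c N₁ J₁ × adelic F E c N₂ J₂) × adelic F E c M JW →*
      adelicMpCont F (Fin N₂ × Fin M)
        (T₂.map (algebraMap F (AdeleRing (𝓞 F) F)) ⊗ₖ TW.map (algebraMap F (AdeleRing (𝓞 F) F))) :=
  ((adelicMpContReindex F e₂
      (T₂.map (algebraMap F (AdeleRing (𝓞 F) F)) ⊗ₖ TW.map (algebraMap F (AdeleRing (𝓞 F) F)))).symm.toMonoidHom.comp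
    (pairSplitting F E c N₂ M e₂ J₂ JW s₂)).comp
    (((MonoidHom.snd (adelic F E c N₁ J₁) (adelic F E c N₂ J₂)).comp
        (MonoidHom.fst (adelic F E c N₁ J₁ × adelic F E c N₂ J₂) (adelic F E c M JW))).prod
      (MonoidHom.snd (adelic F E c N₁ J₁ × adelic F E c N₂ J₂) (adelic F E c M JW)))

/-- Unfolding: `((g₁,g₂),u) ↦ s_{2,pair}(g₂, u)` read back along `e₂`. [cite: Kudla1984, §1] -/
theorem seesawSmallLeft₂_apply (s₂ : adelicPair F E c N₂ M J₂ JW →* adelicMpCont F (Fin n₂) (adelicGram F e₂ T₂ TW))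
    (p : (adelic F E c N₁ J₁ × adelic F E c N₂ J₂) × adelic F E c M JW) :
    seesawSmallLeft₂ F E c N₁ N₂ M e₂ J₁ J₂ JW s₂ p =
      (adelicMpContReindex F e₂
        (T₂.map (algebraMap F (AdeleRing (𝓞 F) F)) ⊗ₖ TW.map (algebraMap F (AdeleRing (𝓞 F) F)))).symm
        (pairSplitting F E c N₂ M e₂ J₂ JW s₂ (p.1.2, p.2)) :=
  rfl

/-! ### Weil operators (read back along the enumerations) -/

/-- `ω(seesawBigLeft s p) Φ = R_{e_V}⁻¹ (ω(s_pair(g₁ ⊕ᶠ g₂, u)) (R_{e_V} Φ))` (transport of the Weil representation along the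
relabelling of the symplectic basis). [cite: MoeglinVignerasWaldspurger1987, Chap. 2 II.1] -/
theorem omega_seesawBigLeft_apply (s : adelicPair F E c (N₁ + N₂) M (finSum N₁ N₂ J₁ J₂) JW →*
      adelicMpCont F (Fin n) (adelicGram F eV (finSum N₁ N₂ T₁ T₂) TW))
    (p : (adelic F E c N₁ J₁ × adelic F E c N₂ J₂) × adelic F E c M JW)
    (Φ : piSchwartzBruhat F (Fin (N₁ + N₂) × Fin M)) :
    adelicMpCont.omega F (Fin (N₁ + N₂) × Fin M)
        ((finSum N₁ N₂ T₁ T₂).map (algebraMap F (AdeleRing (𝓞 F) F)) ⊗ₖ TW.map (algebraMap F (AdeleRing (𝓞 F) F)))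
        (seesawBigLeft F E c N₁ N₂ M eV J₁ J₂ JW s p) Φ =
      (piSBReindex F eV).symm
        (adelicMpCont.omega F (Fin n) (adelicGram F eV (finSum N₁ N₂ T₁ T₂) TW)
          (pairSplitting F E c (N₁ + N₂) M eV (finSum N₁ N₂ J₁ J₂) JW s (adelicBlockDiag F E c N₁ N₂ J₁ J₂ p.1, p.2))
          (piSBReindex F eV Φ)) :=
  adelicMpCont.omega_reindex_symm_apply F eV _ _ Φ

/-- `ω(seesawSmallLeft₁ s₁ p) Φ = R_{e₁}⁻¹ (ω(s_{1,pair}(g₁, u)) (R_{e₁} Φ))`. [cite: MoeglinVignerasWaldspurger1987, Chap. 2 II.1] -/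
theorem omega_seesawSmallLeft₁_apply
    (s₁ : adelicPair F E c N₁ M J₁ JW →* adelicMpCont F (Fin n₁) (adelicGram F e₁ T₁ TW))
    (p : (adelic F E c N₁ J₁ × adelic F E c N₂ J₂) × adelic F E c M JW) (Φ : piSchwartzBruhat F (Fin N₁ × Fin M)) :
    adelicMpCont.omega F (Fin N₁ × Fin M)
        (T₁.map (algebraMap F (AdeleRing (𝓞 F) F)) ⊗ₖ TW.map (algebraMap F (AdeleRing (𝓞 F) F)))
        (seesawSmallLeft₁ F E c N₁ N₂ M e₁ J₁ J₂ JW s₁ p) Φ =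
      (piSBReindex F e₁).symm
        (adelicMpCont.omega F (Fin n₁) (adelicGram F e₁ T₁ TW) (pairSplitting F E c N₁ M e₁ J₁ JW s₁ (p.1.1, p.2))
          (piSBReindex F e₁ Φ)) :=
  adelicMpCont.omega_reindex_symm_apply F e₁ _ _ Φ

/-- `ω(seesawSmallLeft₂ s₂ p) Φ = R_{e₂}⁻¹ (ω(s_{2,pair}(g₂, u)) (R_{e₂} Φ))`. [cite: MoeglinVignerasWaldspurger1987, Chap. 2 II.1] -/
theorem omega_seesawSmallLeft₂_apply
    (s₂ : adelicPair F E c N₂ M J₂ JW →* adelicMpCont F (Fin n₂) (adelicGram F e₂ T₂ TW))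
    (p : (adelic F E c N₁ J₁ × adelic F E c N₂ J₂) × adelic F E c M JW) (Φ : piSchwartzBruhat F (Fin N₂ × Fin M)) :
    adelicMpCont.omega F (Fin N₂ × Fin M)
        (T₂.map (algebraMap F (AdeleRing (𝓞 F) F)) ⊗ₖ TW.map (algebraMap F (AdeleRing (𝓞 F) F)))
        (seesawSmallLeft₂ F E c N₁ N₂ M e₂ J₁ J₂ JW s₂ p) Φ =
      (piSBReindex F e₂).symm
        (adelicMpCont.omega F (Fin n₂) (adelicGram F e₂ T₂ TW) (pairSplitting F E c N₂ M e₂ J₂ JW s₂ (p.1.2, p.2))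
          (piSBReindex F e₂ Φ)) :=
  adelicMpCont.omega_reindex_symm_apply F e₂ _ _ Φ

/-! ### Continuity -/

/-- `seesawBigLeft s` is continuous along a continuous pair splitting (the adelic metaplectic group and its splittings are
topological, [GelbartRogawski1991, §3.1 p. 454]). [cite: GelbartRogawski1991, §3.1 p. 454] -/
theorem continuous_seesawBigLeft {s : adelicPair F E c (N₁ + N₂) M (finSum N₁ N₂ J₁ J₂) JW →*
      adelicMpCont F (Fin n) (adelicGram F eV (finSum N₁ N₂ T₁ T₂) TW)}
    (hc : Continuous (pairSplitting F E c (N₁ + N₂) M eV (finSum N₁ N₂ J₁ J₂) JW s))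
    (hsymm : Continuous (adelicMpContReindex F eV
      ((finSum N₁ N₂ T₁ T₂).map (algebraMap F (AdeleRing (𝓞 F) F)) ⊗ₖ TW.map (algebraMap F (AdeleRing (𝓞 F) F)))).symm) :
    Continuous (seesawBigLeft F E c N₁ N₂ M eV J₁ J₂ JW s) :=
  hsymm.comp (hc.comp ((continuous_adelicBlockDiag F E c N₁ N₂ J₁ J₂).prodMap continuous_id))

end Homs

/-! ## §1b Projections and `Θ`-fixing at rational points (compatible splittings) -/

section Compatible

variable (F E : Type) [Field F] [NumberField F] [Field E] [NumberField E] [Algebra F E]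
variable (c : E ≃ₐ[F] E) (N₁ N₂ M : ℕ) {n n₁ n₂ : ℕ}
  (eV : Fin (N₁ + N₂) × Fin M ≃ Fin n) (e₁ : Fin N₁ × Fin M ≃ Fin n₁) (e₂ : Fin N₂ × Fin M ≃ Fin n₂)
variable (J₁ : Matrix (Fin N₁) (Fin N₁) E) (J₂ : Matrix (Fin N₂) (Fin N₂) E) (JW : Matrix (Fin M) (Fin M) E)
variable {T₁ : Matrix (Fin N₁) (Fin N₁) F} {T₂ : Matrix (Fin N₂) (Fin N₂) F} {TW : Matrix (Fin M) (Fin M) F}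
variable [Algebra.IsQuadraticExtension F E] {δ : E} (hcδ : c δ = -δ) (hδ : δ ≠ 0) {d : F}
  (hd : δ * δ = algebraMap F E d) (h₁ : T₁.IsSymm) (h₂ : T₂.IsSymm) (hW : TW.IsSymm) (h₁d : IsUnit T₁.det)
  (h₂d : IsUnit T₂.det) (hWd : IsUnit TW.det) (hVd : IsUnit (finSum N₁ N₂ T₁ T₂).det)
  (hJ₁ : J₁ = T₁.map (algebraMap F E)) (hJ₂ : J₂ = T₂.map (algebraMap F E)) (hJW : JW = TW.map (algebraMap F E))

variable {s : adelicPair F E c (N₁ + N₂) M (finSum N₁ N₂ J₁ J₂) JW →*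
    adelicMpCont F (Fin n) (adelicGram F eV (finSum N₁ N₂ T₁ T₂) TW)}
  {s₁ : adelicPair F E c N₁ M J₁ JW →* adelicMpCont F (Fin n₁) (adelicGram F e₁ T₁ TW)}
  {s₂ : adelicPair F E c N₂ M J₂ JW →* adelicMpCont F (Fin n₂) (adelicGram F e₂ T₂ TW)}

/-- **`π(seesawBigLeft s ((g₁, g₂), u)) = ι_{V₁ ⊕ V₂, W}((g₁ ⊕ᶠ g₂) ⊗ u)`** (unitary-2's `adelicPairToSymplectic`), for a
compatible `s`. [cite: GelbartRogawski1991, §3.1 Prop. 3.1.1 p. 455 L1–3] -/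
theorem proj_seesawBigLeft
    (hs : (splittingDatum F E c (N₁ + N₂) M eV (finSum N₁ N₂ J₁ J₂) JW hcδ hδ hd (isSymm_finSum h₁ h₂) hW hVd hWd
      (finSum_eq_map_finSum F E N₁ N₂ J₁ J₂ hJ₁ hJ₂) hJW).IsCompatible s)
    (p : (adelic F E c N₁ J₁ × adelic F E c N₂ J₂) × adelic F E c M JW) :
    adelicMpCont.proj F (Fin (N₁ + N₂) × Fin M)
        ((finSum N₁ N₂ T₁ T₂).map (algebraMap F (AdeleRing (𝓞 F) F)) ⊗ₖ TW.map (algebraMap F (AdeleRing (𝓞 F) F)))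
        (seesawBigLeft F E c N₁ N₂ M eV J₁ J₂ JW s p) =
      adelicPairToSymplectic F E c (N₁ + N₂) M hcδ hδ hd (isSymm_finSum h₁ h₂) hW
        (finSum_eq_map_finSum F E N₁ N₂ J₁ J₂ hJ₁ hJ₂) hJW
        (dualPair (conjAdele F E c) (adelicForm E (N₁ + N₂) (finSum N₁ N₂ J₁ J₂)) (adelicForm E M JW)
          (adelicBlockDiag F E c N₁ N₂ J₁ J₂ p.1, p.2)) :=
  adelicMpCont.proj_reindex_symm_eq F eV _
    ((proj_pairSplitting F E c (N₁ + N₂) M eV (finSum N₁ N₂ J₁ J₂) JW hcδ hδ hd (isSymm_finSum h₁ h₂) hW hVd hWd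
        (finSum_eq_map_finSum F E N₁ N₂ J₁ J₂ hJ₁ hJ₂) hJW hs (adelicBlockDiag F E c N₁ N₂ J₁ J₂ p.1, p.2)).trans
      (congrArg (fun x => toSp F E c (N₁ + N₂) M eV (finSum N₁ N₂ J₁ J₂) JW hcδ hδ hd (isSymm_finSum h₁ h₂) hW
          (finSum_eq_map_finSum F E N₁ N₂ J₁ J₂ hJ₁ hJ₂) hJW x)
        (adelicInl_mul_adelicInr F E c (N₁ + N₂) (adelicBlockDiag F E c N₁ N₂ J₁ J₂ p.1) p.2)))

/-- **`π(seesawSmallLeft₁ s₁ ((g₁, g₂), u)) = ι_{V₁,W}(g₁ ⊗ u)`**, for a compatible `s₁`.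
[cite: GelbartRogawski1991, §3.1 Prop. 3.1.1 p. 455 L1–3] -/
theorem proj_seesawSmallLeft₁
    (hs₁ : (splittingDatum F E c N₁ M e₁ J₁ JW hcδ hδ hd h₁ hW h₁d hWd hJ₁ hJW).IsCompatible s₁)
    (p : (adelic F E c N₁ J₁ × adelic F E c N₂ J₂) × adelic F E c M JW) :
    adelicMpCont.proj F (Fin N₁ × Fin M)
        (T₁.map (algebraMap F (AdeleRing (𝓞 F) F)) ⊗ₖ TW.map (algebraMap F (AdeleRing (𝓞 F) F)))
        (seesawSmallLeft₁ F E c N₁ N₂ M e₁ J₁ J₂ JW s₁ p) =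
      adelicPairToSymplectic F E c N₁ M hcδ hδ hd h₁ hW hJ₁ hJW
        (dualPair (conjAdele F E c) (adelicForm E N₁ J₁) (adelicForm E M JW) (p.1.1, p.2)) :=
  adelicMpCont.proj_reindex_symm_eq F e₁ _
    ((proj_pairSplitting F E c N₁ M e₁ J₁ JW hcδ hδ hd h₁ hW h₁d hWd hJ₁ hJW hs₁ (p.1.1, p.2)).trans
      (congrArg (fun x => toSp F E c N₁ M e₁ J₁ JW hcδ hδ hd h₁ hW hJ₁ hJW x)
        (adelicInl_mul_adelicInr F E c N₁ p.1.1 p.2)))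

/-- **`π(seesawSmallLeft₂ s₂ ((g₁, g₂), u)) = ι_{V₂,W}(g₂ ⊗ u)`**, for a compatible `s₂`.
[cite: GelbartRogawski1991, §3.1 Prop. 3.1.1 p. 455 L1–3] -/
theorem proj_seesawSmallLeft₂
    (hs₂ : (splittingDatum F E c N₂ M e₂ J₂ JW hcδ hδ hd h₂ hW h₂d hWd hJ₂ hJW).IsCompatible s₂)
    (p : (adelic F E c N₁ J₁ × adelic F E c N₂ J₂) × adelic F E c M JW) :
    adelicMpCont.proj F (Fin N₂ × Fin M)
        (T₂.map (algebraMap F (AdeleRing (𝓞 F) F)) ⊗ₖ TW.map (algebraMap F (AdeleRing (𝓞 F) F)))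
        (seesawSmallLeft₂ F E c N₁ N₂ M e₂ J₁ J₂ JW s₂ p) =
      adelicPairToSymplectic F E c N₂ M hcδ hδ hd h₂ hW hJ₂ hJW
        (dualPair (conjAdele F E c) (adelicForm E N₂ J₂) (adelicForm E M JW) (p.1.2, p.2)) :=
  adelicMpCont.proj_reindex_symm_eq F e₂ _
    ((proj_pairSplitting F E c N₂ M e₂ J₂ JW hcδ hδ hd h₂ hW h₂d hWd hJ₂ hJW hs₂ (p.1.2, p.2)).trans
      (congrArg (fun x => toSp F E c N₂ M e₂ J₂ JW hcδ hδ hd h₂ hW hJ₂ hJW x)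
        (adelicInl_mul_adelicInr F E c N₂ p.1.2 p.2)))

/-- **`Θ`-fixing at rational points, big pair**: for `γ_j ∈ U(J_j)(F)`, `γ_W ∈ U(J_W)(F)`, the value
`seesawBigLeft s ((γ₁, γ₂), γ_W)` is `Θ`-fixing (Weil's Thm 6 through the compatibility of `s`; `γ₁ ⊕ᶠ γ₂` is rational).
[cite: Weil1964, Chap. III n° 41 Thm 6 p. 193] -/
theorem coe_seesawBigLeft_mem_adelicMpTheta
    (hs : (splittingDatum F E c (N₁ + N₂) M eV (finSum N₁ N₂ J₁ J₂) JW hcδ hδ hd (isSymm_finSum h₁ h₂) hW hVd hWd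
      (finSum_eq_map_finSum F E N₁ N₂ J₁ J₂ hJ₁ hJ₂) hJW).IsCompatible s)
    (γ₁ : rational F E c N₁ J₁) (γ₂ : rational F E c N₂ J₂) (γW : rational F E c M JW) :
    ((seesawBigLeft F E c N₁ N₂ M eV J₁ J₂ JW s
        ((toAdelic F E c N₁ J₁ γ₁, toAdelic F E c N₂ J₂ γ₂), toAdelic F E c M JW γW) :
        adelicMpCont F (Fin (N₁ + N₂) × Fin M)
          ((finSum N₁ N₂ T₁ T₂).map (algebraMap F (AdeleRing (𝓞 F) F)) ⊗ₖ TW.map (algebraMap F (AdeleRing (𝓞 F) F)))) :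
        adelicMp F (Fin (N₁ + N₂) × Fin M)
          ((finSum N₁ N₂ T₁ T₂).map (algebraMap F (AdeleRing (𝓞 F) F)) ⊗ₖ TW.map (algebraMap F (AdeleRing (𝓞 F) F)))) ∈
      adelicMpTheta F (Fin (N₁ + N₂) × Fin M)
        ((finSum N₁ N₂ T₁ T₂).map (algebraMap F (AdeleRing (𝓞 F) F)) ⊗ₖ TW.map (algebraMap F (AdeleRing (𝓞 F) F))) :=
  (coe_adelicMpContReindex_symm_mem_adelicMpTheta_iff F eV _ _).2
    ((MpPsi.mem_fixing_iff _ _ _).2 fun Φ =>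
      thetaDistLM_pairRep_rat F E c (N₁ + N₂) M eV (finSum N₁ N₂ J₁ J₂) JW hcδ hδ hd (isSymm_finSum h₁ h₂) hW hVd hWd
        (finSum_eq_map_finSum F E N₁ N₂ J₁ J₂ hJ₁ hJ₂) hJW hs
        (adelicBlockDiag_toAdelic_mem_range F E c N₁ N₂ J₁ J₂ γ₁ γ₂) ⟨γW, rfl⟩ Φ)

/-- **`Θ`-fixing at rational points, first small pair.** [cite: Weil1964, Chap. III n° 41 Thm 6 p. 193] -/
theorem coe_seesawSmallLeft₁_mem_adelicMpTheta
    (hs₁ : (splittingDatum F E c N₁ M e₁ J₁ JW hcδ hδ hd h₁ hW h₁d hWd hJ₁ hJW).IsCompatible s₁)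
    (γ₁ : rational F E c N₁ J₁) (g₂ : adelic F E c N₂ J₂) (γW : rational F E c M JW) :
    ((seesawSmallLeft₁ F E c N₁ N₂ M e₁ J₁ J₂ JW s₁ ((toAdelic F E c N₁ J₁ γ₁, g₂), toAdelic F E c M JW γW) :
        adelicMpCont F (Fin N₁ × Fin M)
          (T₁.map (algebraMap F (AdeleRing (𝓞 F) F)) ⊗ₖ TW.map (algebraMap F (AdeleRing (𝓞 F) F)))) :
        adelicMp F (Fin N₁ × Fin M)
          (T₁.map (algebraMap F (AdeleRing (𝓞 F) F)) ⊗ₖ TW.map (algebraMap F (AdeleRing (𝓞 F) F)))) ∈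
      adelicMpTheta F (Fin N₁ × Fin M)
        (T₁.map (algebraMap F (AdeleRing (𝓞 F) F)) ⊗ₖ TW.map (algebraMap F (AdeleRing (𝓞 F) F))) :=
  (coe_adelicMpContReindex_symm_mem_adelicMpTheta_iff F e₁ _ _).2
    ((MpPsi.mem_fixing_iff _ _ _).2 fun Φ =>
      thetaDistLM_pairRep_rat F E c N₁ M e₁ J₁ JW hcδ hδ hd h₁ hW h₁d hWd hJ₁ hJW hs₁ ⟨γ₁, rfl⟩ ⟨γW, rfl⟩ Φ)

/-- **`Θ`-fixing at rational points, second small pair.** [cite: Weil1964, Chap. III n° 41 Thm 6 p. 193] -/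
theorem coe_seesawSmallLeft₂_mem_adelicMpTheta
    (hs₂ : (splittingDatum F E c N₂ M e₂ J₂ JW hcδ hδ hd h₂ hW h₂d hWd hJ₂ hJW).IsCompatible s₂)
    (g₁ : adelic F E c N₁ J₁) (γ₂ : rational F E c N₂ J₂) (γW : rational F E c M JW) :
    ((seesawSmallLeft₂ F E c N₁ N₂ M e₂ J₁ J₂ JW s₂ ((g₁, toAdelic F E c N₂ J₂ γ₂), toAdelic F E c M JW γW) :
        adelicMpCont F (Fin N₂ × Fin M)
          (T₂.map (algebraMap F (AdeleRing (𝓞 F) F)) ⊗ₖ TW.map (algebraMap F (AdeleRing (𝓞 F) F)))) :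
        adelicMp F (Fin N₂ × Fin M)
          (T₂.map (algebraMap F (AdeleRing (𝓞 F) F)) ⊗ₖ TW.map (algebraMap F (AdeleRing (𝓞 F) F)))) ∈
      adelicMpTheta F (Fin N₂ × Fin M)
        (T₂.map (algebraMap F (AdeleRing (𝓞 F) F)) ⊗ₖ TW.map (algebraMap F (AdeleRing (𝓞 F) F))) :=
  (coe_adelicMpContReindex_symm_mem_adelicMpTheta_iff F e₂ _ _).2
    ((MpPsi.mem_fixing_iff _ _ _).2 fun Φ =>
      thetaDistLM_pairRep_rat F E c N₂ M e₂ J₂ JW hcδ hδ hd h₂ hW h₂d hWd hJ₂ hJW hs₂ ⟨γ₂, rfl⟩ ⟨γW, rfl⟩ Φ)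

/-! ## §2 The see-saw hypothesis and the character -/

/-- the Gram identity along `e_Σ = (finSumFinEquiv × 1)⁻¹ ≫ Equiv.sumProdDistrib`:
`reindex ((T₁ ⊕ᶠ T₂) ⊗ T_W ⊗ 1) = (T₁ ⊗ T_W ⊗ 1) ⊕ (T₂ ⊗ T_W ⊗ 1)` — the orthogonal decomposition
`(V₁ ⊕ V₂) ⊗ W = (V₁ ⊗ W) ⊕ (V₂ ⊗ W)`. [cite: Kudla1984, §1] -/
theorem reindex_gram_finSum_left :
    Matrix.reindex
        ((finSumFinEquiv.prodCongr (Equiv.refl (Fin M))).symm.trans (Equiv.sumProdDistrib (Fin N₁) (Fin N₂) (Fin M)))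
        ((finSumFinEquiv.prodCongr (Equiv.refl (Fin M))).symm.trans (Equiv.sumProdDistrib (Fin N₁) (Fin N₂) (Fin M)))
        ((finSum N₁ N₂ T₁ T₂).map (algebraMap F (AdeleRing (𝓞 F) F)) ⊗ₖ TW.map (algebraMap F (AdeleRing (𝓞 F) F))) =
      Matrix.fromBlocks (T₁.map (algebraMap F (AdeleRing (𝓞 F) F)) ⊗ₖ TW.map (algebraMap F (AdeleRing (𝓞 F) F))) 0 0
        (T₂.map (algebraMap F (AdeleRing (𝓞 F) F)) ⊗ₖ TW.map (algebraMap F (AdeleRing (𝓞 F) F))) := by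
  rw [finSum_map]
  exact reindex_finSum_kronecker _ _ _

/-- **THE V-SIDE SEE-SAW HYPOTHESIS `hS` at the splitting data of record**: read through
`e_Σ = (finSumFinEquiv × 1)⁻¹ ≫ Equiv.sumProdDistrib`, `π(seesawBigLeft s p) = π(seesawSmallLeft₁ s₁ p) ⊕ π(seesawSmallLeft₂ s₂ p)`
— unitary-2's `adelicPairToSymplectic_adelicBlockDiag_dualPair`. [cite: Kudla1984, §1] -/
theorem hS_seesawLeft
    (hs : (splittingDatum F E c (N₁ + N₂) M eV (finSum N₁ N₂ J₁ J₂) JW hcδ hδ hd (isSymm_finSum h₁ h₂) hW hVd hWd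
      (finSum_eq_map_finSum F E N₁ N₂ J₁ J₂ hJ₁ hJ₂) hJW).IsCompatible s)
    (hs₁ : (splittingDatum F E c N₁ M e₁ J₁ JW hcδ hδ hd h₁ hW h₁d hWd hJ₁ hJW).IsCompatible s₁)
    (hs₂ : (splittingDatum F E c N₂ M e₂ J₂ JW hcδ hδ hd h₂ hW h₂d hWd hJ₂ hJW).IsCompatible s₂)
    (p : (adelic F E c N₁ J₁ × adelic F E c N₂ J₂) × adelic F E c M JW) :
    (spReindex ((finSumFinEquiv.prodCongr (Equiv.refl (Fin M))).symm.trans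
          (Equiv.sumProdDistrib (Fin N₁) (Fin N₂) (Fin M)))
        ((finSum N₁ N₂ T₁ T₂).map (algebraMap F (AdeleRing (𝓞 F) F)) ⊗ₖ TW.map (algebraMap F (AdeleRing (𝓞 F) F)))
        (adelicMpCont.proj F (Fin (N₁ + N₂) × Fin M)
          ((finSum N₁ N₂ T₁ T₂).map (algebraMap F (AdeleRing (𝓞 F) F)) ⊗ₖ TW.map (algebraMap F (AdeleRing (𝓞 F) F)))
          (seesawBigLeft F E c N₁ N₂ M eV J₁ J₂ JW s p))).1 =
      (spSum (T₁.map (algebraMap F (AdeleRing (𝓞 F) F)) ⊗ₖ TW.map (algebraMap F (AdeleRing (𝓞 F) F)))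
        (T₂.map (algebraMap F (AdeleRing (𝓞 F) F)) ⊗ₖ TW.map (algebraMap F (AdeleRing (𝓞 F) F)))
        (adelicMpCont.proj F (Fin N₁ × Fin M)
            (T₁.map (algebraMap F (AdeleRing (𝓞 F) F)) ⊗ₖ TW.map (algebraMap F (AdeleRing (𝓞 F) F)))
            (seesawSmallLeft₁ F E c N₁ N₂ M e₁ J₁ J₂ JW s₁ p),
          adelicMpCont.proj F (Fin N₂ × Fin M)
            (T₂.map (algebraMap F (AdeleRing (𝓞 F) F)) ⊗ₖ TW.map (algebraMap F (AdeleRing (𝓞 F) F)))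
            (seesawSmallLeft₂ F E c N₁ N₂ M e₂ J₁ J₂ JW s₂ p))).1 :=
  ((congrArg (fun x => (spReindex ((finSumFinEquiv.prodCongr (Equiv.refl (Fin M))).symm.trans
          (Equiv.sumProdDistrib (Fin N₁) (Fin N₂) (Fin M)))
      ((finSum N₁ N₂ T₁ T₂).map (algebraMap F (AdeleRing (𝓞 F) F)) ⊗ₖ TW.map (algebraMap F (AdeleRing (𝓞 F) F))) x).1)
      (proj_seesawBigLeft F E c N₁ N₂ M eV J₁ J₂ JW hcδ hδ hd h₁ h₂ hW hWd hVd hJ₁ hJ₂ hJW hs p)).trans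
    (adelicPairToSymplectic_adelicBlockDiag_dualPair F E c N₁ N₂ M hcδ hδ hd h₁ h₂ hW hJ₁ hJ₂ hJW p.1 p.2)).trans
    (congrArg₂ (fun x y => (spSum (T₁.map (algebraMap F (AdeleRing (𝓞 F) F)) ⊗ₖ TW.map (algebraMap F (AdeleRing (𝓞 F) F)))
        (T₂.map (algebraMap F (AdeleRing (𝓞 F) F)) ⊗ₖ TW.map (algebraMap F (AdeleRing (𝓞 F) F))) (x, y)).1)
      (proj_seesawSmallLeft₁ F E c N₁ N₂ M e₁ J₁ J₂ JW hcδ hδ hd h₁ hW h₁d hWd hJ₁ hJW hs₁ p).symm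
      (proj_seesawSmallLeft₂ F E c N₁ N₂ M e₂ J₁ J₂ JW hcδ hδ hd h₂ hW h₂d hWd hJ₂ hJW hs₂ p).symm)

/-- **THE V-SIDE SEE-SAW CHARACTER AT THE SPLITTING DATA OF RECORD**
`χ : (U(J₁)(𝔸) × U(J₂)(𝔸)) × U(J_W)(𝔸) →* ℂˣ`: `mpSeesawCharSum` along `e_Σ` of `seesawBigLeft s` against
`seesawSmallLeft₁ s₁`, `seesawSmallLeft₂ s₂`. (cf. R. Howe (1979) §3; S. Kudla (1984) §1; S. Gelbart–J. Rogawski (1991) §3.1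
Remark p. 457; [Liu2021] proof of Thm. 4.15, l. 2199–2210) [folklore] -/
def mpSeesawCharLeft
    (hs : (splittingDatum F E c (N₁ + N₂) M eV (finSum N₁ N₂ J₁ J₂) JW hcδ hδ hd (isSymm_finSum h₁ h₂) hW hVd hWd
      (finSum_eq_map_finSum F E N₁ N₂ J₁ J₂ hJ₁ hJ₂) hJW).IsCompatible s)
    (hs₁ : (splittingDatum F E c N₁ M e₁ J₁ JW hcδ hδ hd h₁ hW h₁d hWd hJ₁ hJW).IsCompatible s₁)
    (hs₂ : (splittingDatum F E c N₂ M e₂ J₂ JW hcδ hδ hd h₂ hW h₂d hWd hJ₂ hJW).IsCompatible s₂) :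
    (adelic F E c N₁ J₁ × adelic F E c N₂ J₂) × adelic F E c M JW →* ℂˣ :=
  mpSeesawCharSum ((finSumFinEquiv.prodCongr (Equiv.refl (Fin M))).symm.trans
      (Equiv.sumProdDistrib (Fin N₁) (Fin N₂) (Fin M))) (reindex_gram_finSum_left F N₁ N₂ M)
    (seesawBigLeft F E c N₁ N₂ M eV J₁ J₂ JW s) (seesawSmallLeft₁ F E c N₁ N₂ M e₁ J₁ J₂ JW s₁)
    (seesawSmallLeft₂ F E c N₁ N₂ M e₂ J₁ J₂ JW s₂)
    (hS_seesawLeft F E c N₁ N₂ M eV e₁ e₂ J₁ J₂ JW hcδ hδ hd h₁ h₂ hW h₁d h₂d hWd hVd hJ₁ hJ₂ hJW hs hs₁ hs₂)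
    (isUnit_kronecker_map F N₁ h₁d hWd) (isUnit_kronecker_map F N₂ h₂d hWd)

/-- By definition `mpSeesawCharLeft … = mpSeesawCharSum e_Σ _ (seesawBigLeft s) (seesawSmallLeft₁ s₁) (seesawSmallLeft₂ s₂) …`
— so all of `AdelicMetaplecticSeesawSum` / `AdelicMetaplecticSeesawCharacter` applies. [cite: Howe1979, §3] -/
theorem mpSeesawCharLeft_def
    (hs : (splittingDatum F E c (N₁ + N₂) M eV (finSum N₁ N₂ J₁ J₂) JW hcδ hδ hd (isSymm_finSum h₁ h₂) hW hVd hWd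
      (finSum_eq_map_finSum F E N₁ N₂ J₁ J₂ hJ₁ hJ₂) hJW).IsCompatible s)
    (hs₁ : (splittingDatum F E c N₁ M e₁ J₁ JW hcδ hδ hd h₁ hW h₁d hWd hJ₁ hJW).IsCompatible s₁)
    (hs₂ : (splittingDatum F E c N₂ M e₂ J₂ JW hcδ hδ hd h₂ hW h₂d hWd hJ₂ hJW).IsCompatible s₂) :
    mpSeesawCharLeft F E c N₁ N₂ M eV e₁ e₂ J₁ J₂ JW hcδ hδ hd h₁ h₂ hW h₁d h₂d hWd hVd hJ₁ hJ₂ hJW hs hs₁ hs₂ =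
      mpSeesawCharSum ((finSumFinEquiv.prodCongr (Equiv.refl (Fin M))).symm.trans
          (Equiv.sumProdDistrib (Fin N₁) (Fin N₂) (Fin M))) (reindex_gram_finSum_left F N₁ N₂ M)
        (seesawBigLeft F E c N₁ N₂ M eV J₁ J₂ JW s) (seesawSmallLeft₁ F E c N₁ N₂ M e₁ J₁ J₂ JW s₁)
        (seesawSmallLeft₂ F E c N₁ N₂ M e₂ J₁ J₂ JW s₂)
        (hS_seesawLeft F E c N₁ N₂ M eV e₁ e₂ J₁ J₂ JW hcδ hδ hd h₁ h₂ hW h₁d h₂d hWd hVd hJ₁ hJ₂ hJW hs hs₁ hs₂)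
        (isUnit_kronecker_map F N₁ h₁d hWd) (isUnit_kronecker_map F N₂ h₂d hWd) :=
  rfl

/-- **The V-side restriction identity of the oscillator representation** (Kronecker coordinates `Fin (N₁ + N₂) × Fin M`):
`ω(s_pair(g₁ ⊕ᶠ g₂, u)) (Φ₁ ⊠ Φ₂) = χ((g₁, g₂), u) • (ω(s_{1,pair}(g₁, u)) Φ₁ ⊠ ω(s_{2,pair}(g₂, u)) Φ₂)`, the tensor read
through `e_Σ` (`sumTensor`) — [Liu2021]'s «the restriction of `ω_{μ,ε}` to `U(V⋆) × U(V⋆^⊥)`» for pure tensors, up to the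
automorphic character `χ`. [cite: Howe1979, §3] [cite: Kudla1984, §1] -/
theorem mpSeesawCharLeft_spec
    (hs : (splittingDatum F E c (N₁ + N₂) M eV (finSum N₁ N₂ J₁ J₂) JW hcδ hδ hd (isSymm_finSum h₁ h₂) hW hVd hWd
      (finSum_eq_map_finSum F E N₁ N₂ J₁ J₂ hJ₁ hJ₂) hJW).IsCompatible s)
    (hs₁ : (splittingDatum F E c N₁ M e₁ J₁ JW hcδ hδ hd h₁ hW h₁d hWd hJ₁ hJW).IsCompatible s₁)
    (hs₂ : (splittingDatum F E c N₂ M e₂ J₂ JW hcδ hδ hd h₂ hW h₂d hWd hJ₂ hJW).IsCompatible s₂)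
    (p : (adelic F E c N₁ J₁ × adelic F E c N₂ J₂) × adelic F E c M JW)
    (Φ₁ : piSchwartzBruhat F (Fin N₁ × Fin M)) (Φ₂ : piSchwartzBruhat F (Fin N₂ × Fin M)) :
    adelicMpCont.omega F (Fin (N₁ + N₂) × Fin M)
        ((finSum N₁ N₂ T₁ T₂).map (algebraMap F (AdeleRing (𝓞 F) F)) ⊗ₖ TW.map (algebraMap F (AdeleRing (𝓞 F) F)))
        (seesawBigLeft F E c N₁ N₂ M eV J₁ J₂ JW s p)
        (sumTensor F ((finSumFinEquiv.prodCongr (Equiv.refl (Fin M))).symm.trans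
          (Equiv.sumProdDistrib (Fin N₁) (Fin N₂) (Fin M))) Φ₁ Φ₂) =
      (mpSeesawCharLeft F E c N₁ N₂ M eV e₁ e₂ J₁ J₂ JW hcδ hδ hd h₁ h₂ hW h₁d h₂d hWd hVd hJ₁ hJ₂ hJW hs hs₁ hs₂ p : ℂ) •
        sumTensor F ((finSumFinEquiv.prodCongr (Equiv.refl (Fin M))).symm.trans
            (Equiv.sumProdDistrib (Fin N₁) (Fin N₂) (Fin M)))
          (adelicMpCont.omega F (Fin N₁ × Fin M)
            (T₁.map (algebraMap F (AdeleRing (𝓞 F) F)) ⊗ₖ TW.map (algebraMap F (AdeleRing (𝓞 F) F)))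
            (seesawSmallLeft₁ F E c N₁ N₂ M e₁ J₁ J₂ JW s₁ p) Φ₁)
          (adelicMpCont.omega F (Fin N₂ × Fin M)
            (T₂.map (algebraMap F (AdeleRing (𝓞 F) F)) ⊗ₖ TW.map (algebraMap F (AdeleRing (𝓞 F) F)))
            (seesawSmallLeft₂ F E c N₁ N₂ M e₂ J₁ J₂ JW s₂ p) Φ₂) :=
  mpSeesawCharSum_spec ((finSumFinEquiv.prodCongr (Equiv.refl (Fin M))).symm.trans
      (Equiv.sumProdDistrib (Fin N₁) (Fin N₂) (Fin M))) (reindex_gram_finSum_left F N₁ N₂ M) _ _ _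
    (hS_seesawLeft F E c N₁ N₂ M eV e₁ e₂ J₁ J₂ JW hcδ hδ hd h₁ h₂ hW h₁d h₂d hWd hVd hJ₁ hJ₂ hJW hs hs₁ hs₂) _ _ p Φ₁ Φ₂

/-- **`χ = 1` ON RATIONAL POINTS**: the three compatible splittings differ on the V-side see-saw by an AUTOMORPHIC
character ([GelbartRogawski1991, §3.1 Remark p. 457] in kernel form; Weil's Thm 6 at the three rational values) — so
[Liu2021]'s theta FUNCTIONS on `U(V)(F)\U(V)(𝔸)` restrict to products of theta functions with no extra factor at rational
arguments. [cite: Weil1964, Chap. III n° 41 Thm 6 p. 193] -/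
theorem mpSeesawCharLeft_eq_one_of_rational
    (hs : (splittingDatum F E c (N₁ + N₂) M eV (finSum N₁ N₂ J₁ J₂) JW hcδ hδ hd (isSymm_finSum h₁ h₂) hW hVd hWd
      (finSum_eq_map_finSum F E N₁ N₂ J₁ J₂ hJ₁ hJ₂) hJW).IsCompatible s)
    (hs₁ : (splittingDatum F E c N₁ M e₁ J₁ JW hcδ hδ hd h₁ hW h₁d hWd hJ₁ hJW).IsCompatible s₁)
    (hs₂ : (splittingDatum F E c N₂ M e₂ J₂ JW hcδ hδ hd h₂ hW h₂d hWd hJ₂ hJW).IsCompatible s₂)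
    (γ₁ : rational F E c N₁ J₁) (γ₂ : rational F E c N₂ J₂) (γW : rational F E c M JW) :
    mpSeesawCharLeft F E c N₁ N₂ M eV e₁ e₂ J₁ J₂ JW hcδ hδ hd h₁ h₂ hW h₁d h₂d hWd hVd hJ₁ hJ₂ hJW hs hs₁ hs₂
        ((toAdelic F E c N₁ J₁ γ₁, toAdelic F E c N₂ J₂ γ₂), toAdelic F E c M JW γW) = 1 :=
  mpSeesawCharSum_eq_one_of_mem_adelicMpTheta ((finSumFinEquiv.prodCongr (Equiv.refl (Fin M))).symm.trans
      (Equiv.sumProdDistrib (Fin N₁) (Fin N₂) (Fin M))) (reindex_gram_finSum_left F N₁ N₂ M) _ _ _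
    (hS_seesawLeft F E c N₁ N₂ M eV e₁ e₂ J₁ J₂ JW hcδ hδ hd h₁ h₂ hW h₁d h₂d hWd hVd hJ₁ hJ₂ hJW hs hs₁ hs₂) _ _
    (coe_seesawBigLeft_mem_adelicMpTheta F E c N₁ N₂ M eV J₁ J₂ JW hcδ hδ hd h₁ h₂ hW hWd hVd hJ₁ hJ₂ hJW hs γ₁ γ₂ γW)
    (coe_seesawSmallLeft₁_mem_adelicMpTheta F E c N₁ N₂ M e₁ J₁ J₂ JW hcδ hδ hd h₁ hW h₁d hWd hJ₁ hJW hs₁ γ₁ _ γW)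
    (coe_seesawSmallLeft₂_mem_adelicMpTheta F E c N₁ N₂ M e₂ J₁ J₂ JW hcδ hδ hd h₂ hW h₂d hWd hJ₂ hJW hs₂ _ γ₂ γW)

/-! ## §3 The theta form: [Liu2021]'s «claim» at the level of Weil's theta functional, pure tensors -/

/-- `Θ_κ(R_e⁻¹(Φ₁ ⊠ Φ₂)) = Θ_{κ₁}(Φ₁) · Θ_{κ₂}(Φ₂)`: Weil's theta functional is multiplicative on pure tensors read through
any decomposition `e : κ ≃ κ₁ ⊕ κ₂` (file-private junction of `thetaDistLM_piSBReindex` and `thetaDistLM_tensorToSum`).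
[folklore] -/
private theorem thetaDistLM_sumTensor_aux {κ κ₁ κ₂ : Type} [Fintype κ] [DecidableEq κ] [Fintype κ₁] [DecidableEq κ₁]
    [Fintype κ₂] [DecidableEq κ₂] (e : κ ≃ κ₁ ⊕ κ₂) (Φ₁ : piSchwartzBruhat F κ₁) (Φ₂ : piSchwartzBruhat F κ₂) :
    thetaDistLM F κ (sumTensor F e Φ₁ Φ₂) = thetaDistLM F κ₁ Φ₁ * thetaDistLM F κ₂ Φ₂ := by
  rw [← thetaDistLM_piSBReindex F e (sumTensor F e Φ₁ Φ₂), piSBReindex_sumTensor, thetaDistLM_tensorToSum]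

/-- **[Liu2021]'s «claim» (proof of Thm. 4.15, l. 2199–2210) at the level of Weil's theta functional, for pure tensors**:
`Θ(ω(s_pair(g₁ ⊕ᶠ g₂, u)) (Φ₁ ⊠ Φ₂)) = χ((g₁,g₂),u) · Θ(ω(s_{1,pair}(g₁, u)) Φ₁) · Θ(ω(s_{2,pair}(g₂, u)) Φ₂)` — the theta
kernel of the big pair `(U(V₁ ⊕ V₂), U(W))` restricted to `(U(V₁) × U(V₂)) × U(W)` is the product of the two small theta
kernels up to the automorphic see-saw character `χ` (print: «θ_μ^φ(g⋆) = Σ_i (Σ_{v⋆^⊥} φ⋆,i^⊥(v⋆^⊥)) θ_μ^{φ⋆,i}(g⋆)», display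
l. 2204–2208, with the `V⋆^⊥`-factor kept as a function of `g^⊥`). [cite: Liu2021, proof of Thm. 4.15 (FJcycle.tex l. 2199–2210)]
[cite: Kudla1984, §1] -/
theorem thetaDistLM_omega_seesawBigLeft_sumTensor
    (hs : (splittingDatum F E c (N₁ + N₂) M eV (finSum N₁ N₂ J₁ J₂) JW hcδ hδ hd (isSymm_finSum h₁ h₂) hW hVd hWd
      (finSum_eq_map_finSum F E N₁ N₂ J₁ J₂ hJ₁ hJ₂) hJW).IsCompatible s)
    (hs₁ : (splittingDatum F E c N₁ M e₁ J₁ JW hcδ hδ hd h₁ hW h₁d hWd hJ₁ hJW).IsCompatible s₁)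
    (hs₂ : (splittingDatum F E c N₂ M e₂ J₂ JW hcδ hδ hd h₂ hW h₂d hWd hJ₂ hJW).IsCompatible s₂)
    (p : (adelic F E c N₁ J₁ × adelic F E c N₂ J₂) × adelic F E c M JW)
    (Φ₁ : piSchwartzBruhat F (Fin N₁ × Fin M)) (Φ₂ : piSchwartzBruhat F (Fin N₂ × Fin M)) :
    thetaDistLM F (Fin (N₁ + N₂) × Fin M)
        (adelicMpCont.omega F (Fin (N₁ + N₂) × Fin M)
          ((finSum N₁ N₂ T₁ T₂).map (algebraMap F (AdeleRing (𝓞 F) F)) ⊗ₖ TW.map (algebraMap F (AdeleRing (𝓞 F) F)))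
          (seesawBigLeft F E c N₁ N₂ M eV J₁ J₂ JW s p)
          (sumTensor F ((finSumFinEquiv.prodCongr (Equiv.refl (Fin M))).symm.trans
            (Equiv.sumProdDistrib (Fin N₁) (Fin N₂) (Fin M))) Φ₁ Φ₂)) =
      (mpSeesawCharLeft F E c N₁ N₂ M eV e₁ e₂ J₁ J₂ JW hcδ hδ hd h₁ h₂ hW h₁d h₂d hWd hVd hJ₁ hJ₂ hJW hs hs₁ hs₂ p : ℂ) *
        (thetaDistLM F (Fin N₁ × Fin M)
            (adelicMpCont.omega F (Fin N₁ × Fin M)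
              (T₁.map (algebraMap F (AdeleRing (𝓞 F) F)) ⊗ₖ TW.map (algebraMap F (AdeleRing (𝓞 F) F)))
              (seesawSmallLeft₁ F E c N₁ N₂ M e₁ J₁ J₂ JW s₁ p) Φ₁) *
          thetaDistLM F (Fin N₂ × Fin M)
            (adelicMpCont.omega F (Fin N₂ × Fin M)
              (T₂.map (algebraMap F (AdeleRing (𝓞 F) F)) ⊗ₖ TW.map (algebraMap F (AdeleRing (𝓞 F) F)))
              (seesawSmallLeft₂ F E c N₁ N₂ M e₂ J₁ J₂ JW s₂ p) Φ₂)) := by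
  refine (congrArg (thetaDistLM F (Fin (N₁ + N₂) × Fin M))
    (mpSeesawCharLeft_spec F E c N₁ N₂ M eV e₁ e₂ J₁ J₂ JW hcδ hδ hd h₁ h₂ hW h₁d h₂d hWd hVd hJ₁ hJ₂ hJW hs hs₁ hs₂
      p Φ₁ Φ₂)).trans ?_
  refine (LinearMap.map_smul (thetaDistLM F (Fin (N₁ + N₂) × Fin M)) _ _).trans ?_
  exact congrArg (fun t : ℂ =>
      (mpSeesawCharLeft F E c N₁ N₂ M eV e₁ e₂ J₁ J₂ JW hcδ hδ hd h₁ h₂ hW h₁d h₂d hWd hVd hJ₁ hJ₂ hJW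
        hs hs₁ hs₂ p : ℂ) * t)
    (thetaDistLM_sumTensor_aux F _ _ _)

set_option maxHeartbeats 1600000 in
/-- **… at RATIONAL arguments the character drops out**: for `γ_j ∈ U(J_j)(F)`, `γ_W ∈ U(J_W)(F)`,
`Θ(ω(s_pair(γ₁ ⊕ᶠ γ₂, γ_W)) (Φ₁ ⊠ Φ₂)) = Θ(ω(s_{1,pair}(γ₁, γ_W)) Φ₁) · Θ(ω(s_{2,pair}(γ₂, γ_W)) Φ₂)`.
[cite: Weil1964, Chap. III n° 41 Thm 6 p. 193] [cite: Liu2021, proof of Thm. 4.15 (FJcycle.tex l. 2199–2210)] -/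
theorem thetaDistLM_omega_seesawBigLeft_sumTensor_rational
    (hs : (splittingDatum F E c (N₁ + N₂) M eV (finSum N₁ N₂ J₁ J₂) JW hcδ hδ hd (isSymm_finSum h₁ h₂) hW hVd hWd
      (finSum_eq_map_finSum F E N₁ N₂ J₁ J₂ hJ₁ hJ₂) hJW).IsCompatible s)
    (hs₁ : (splittingDatum F E c N₁ M e₁ J₁ JW hcδ hδ hd h₁ hW h₁d hWd hJ₁ hJW).IsCompatible s₁)
    (hs₂ : (splittingDatum F E c N₂ M e₂ J₂ JW hcδ hδ hd h₂ hW h₂d hWd hJ₂ hJW).IsCompatible s₂)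
    (γ₁ : rational F E c N₁ J₁) (γ₂ : rational F E c N₂ J₂) (γW : rational F E c M JW)
    (Φ₁ : piSchwartzBruhat F (Fin N₁ × Fin M)) (Φ₂ : piSchwartzBruhat F (Fin N₂ × Fin M)) :
    thetaDistLM F (Fin (N₁ + N₂) × Fin M)
        (adelicMpCont.omega F (Fin (N₁ + N₂) × Fin M)
          ((finSum N₁ N₂ T₁ T₂).map (algebraMap F (AdeleRing (𝓞 F) F)) ⊗ₖ TW.map (algebraMap F (AdeleRing (𝓞 F) F)))
          (seesawBigLeft F E c N₁ N₂ M eV J₁ J₂ JW s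
            ((toAdelic F E c N₁ J₁ γ₁, toAdelic F E c N₂ J₂ γ₂), toAdelic F E c M JW γW))
          (sumTensor F ((finSumFinEquiv.prodCongr (Equiv.refl (Fin M))).symm.trans
            (Equiv.sumProdDistrib (Fin N₁) (Fin N₂) (Fin M))) Φ₁ Φ₂)) =
      thetaDistLM F (Fin N₁ × Fin M)
          (adelicMpCont.omega F (Fin N₁ × Fin M)
            (T₁.map (algebraMap F (AdeleRing (𝓞 F) F)) ⊗ₖ TW.map (algebraMap F (AdeleRing (𝓞 F) F)))
            (seesawSmallLeft₁ F E c N₁ N₂ M e₁ J₁ J₂ JW s₁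
              ((toAdelic F E c N₁ J₁ γ₁, toAdelic F E c N₂ J₂ γ₂), toAdelic F E c M JW γW)) Φ₁) *
        thetaDistLM F (Fin N₂ × Fin M)
          (adelicMpCont.omega F (Fin N₂ × Fin M)
            (T₂.map (algebraMap F (AdeleRing (𝓞 F) F)) ⊗ₖ TW.map (algebraMap F (AdeleRing (𝓞 F) F)))
            (seesawSmallLeft₂ F E c N₁ N₂ M e₂ J₁ J₂ JW s₂
              ((toAdelic F E c N₁ J₁ γ₁, toAdelic F E c N₂ J₂ γ₂), toAdelic F E c M JW γW)) Φ₂) := by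
  have hχ : (mpSeesawCharLeft F E c N₁ N₂ M eV e₁ e₂ J₁ J₂ JW hcδ hδ hd h₁ h₂ hW h₁d h₂d hWd hVd hJ₁ hJ₂ hJW
      hs hs₁ hs₂ ((toAdelic F E c N₁ J₁ γ₁, toAdelic F E c N₂ J₂ γ₂), toAdelic F E c M JW γW) : ℂ) = 1 :=
    (congrArg Units.val
      (mpSeesawCharLeft_eq_one_of_rational F E c N₁ N₂ M eV e₁ e₂ J₁ J₂ JW hcδ hδ hd h₁ h₂ hW h₁d h₂d hWd hVd
        hJ₁ hJ₂ hJW hs hs₁ hs₂ γ₁ γ₂ γW)).trans Units.val_one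
  refine (thetaDistLM_omega_seesawBigLeft_sumTensor F E c N₁ N₂ M eV e₁ e₂ J₁ J₂ JW hcδ hδ hd h₁ h₂ hW h₁d h₂d hWd
    hVd hJ₁ hJ₂ hJW hs hs₁ hs₂ ((toAdelic F E c N₁ J₁ γ₁, toAdelic F E c N₂ J₂ γ₂), toAdelic F E c M JW γW)
    Φ₁ Φ₂).trans ?_
  generalize (mpSeesawCharLeft F E c N₁ N₂ M eV e₁ e₂ J₁ J₂ JW hcδ hδ hd h₁ h₂ hW h₁d h₂d hWd hVd hJ₁ hJ₂ hJW
      hs hs₁ hs₂ ((toAdelic F E c N₁ J₁ γ₁, toAdelic F E c N₂ J₂ γ₂), toAdelic F E c M JW γW) : ℂ) = z at hχ ⊢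
  subst hχ
  exact one_mul _

end Compatible

/-! ## §4 Function-level assembly over the SPAN of pure tensors ([Liu2021] display l. 2204–2208: «θ_μ^φ(g⋆) = Σ_i (…) θ_μ^{φ⋆,i}(g⋆)»)

Appended 2026-08-28 (cell hodgecm-mathlib (T2) S2 chain, piece (f)): by linearity of `ω(p)` and of Weil's functional `Θ`, the pure-tensor
identity of §3 propagates to every test vector in the `ℂ`-span of the pure tensors `R_{e_Σ}⁻¹(Φ₁ ⊠ Φ₂)` — which by the cell's S2d leaves
(`AdelicSchwartzBruhatDirectSumSpan`, `ArchFollandGaussianSplit`, `ArchFollandHermiteSplit`) contains every adelic test vector whose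
archimedean component is a finite combination of Fock K-types of a frame adapted to the split.  Statement shape chosen for the S2e consumer
(`Automorphic/ThetaClassRestriction`): the restricted theta FUNCTION on the see-saw group is `χ` times an element of the span of PRODUCT functions. -/

section SpanAssembly

/-- Generic linear-algebra core of the span assembly (file-private): if a family of linear functionals `L p` takes the value
`χ p · (L₁ p Φ₁ · L₂ p Φ₂)` on every «pure tensor» `B Φ₁ Φ₂`, then on the span of the pure tensors `L · Φ` is `χ` times an element of the
span of the product functions. [folklore] -/
private theorem exists_mem_span_prod_of_mem_span_aux {V V₁ V₂ P : Type*} [AddCommGroup V] [Module ℂ V]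
    [AddCommGroup V₁] [Module ℂ V₁] [AddCommGroup V₂] [Module ℂ V₂] (B : V₁ → V₂ → V) (L : P → V →ₗ[ℂ] ℂ)
    (L₁ : P → V₁ → ℂ) (L₂ : P → V₂ → ℂ) (χ : P → ℂ)
    (hgen : ∀ (Φ₁ : V₁) (Φ₂ : V₂) (p : P), L p (B Φ₁ Φ₂) = χ p * (L₁ p Φ₁ * L₂ p Φ₂)) {Φ : V}
    (hΦ : Φ ∈ Submodule.span ℂ (Set.range fun ΦΦ : V₁ × V₂ => B ΦΦ.1 ΦΦ.2)) :
    ∃ θ ∈ Submodule.span ℂ (Set.range fun ΦΦ : V₁ × V₂ => fun p : P => L₁ p ΦΦ.1 * L₂ p ΦΦ.2),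
      ∀ p, L p Φ = χ p * θ p := by
  induction hΦ using Submodule.span_induction with
  | mem x hx =>
    obtain ⟨ΦΦ, rfl⟩ := hx
    exact ⟨_, Submodule.subset_span ⟨ΦΦ, rfl⟩, fun p => hgen ΦΦ.1 ΦΦ.2 p⟩
  | zero =>
    exact ⟨0, Submodule.zero_mem _, fun p => by rw [map_zero, Pi.zero_apply, mul_zero]⟩
  | add x y _ _ hx hy =>
    obtain ⟨θ, hθ, hxθ⟩ := hx
    obtain ⟨θ', hθ', hyθ'⟩ := hy
    exact ⟨θ + θ', Submodule.add_mem _ hθ hθ', fun p => by rw [map_add, hxθ p, hyθ' p, Pi.add_apply, mul_add]⟩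
  | smul a x _ hx =>
    obtain ⟨θ, hθ, hxθ⟩ := hx
    exact ⟨a • θ, Submodule.smul_mem _ a hθ, fun p => by
      rw [map_smul, hxθ p, Pi.smul_apply, smul_eq_mul, smul_eq_mul, mul_left_comm]⟩

/-- Generic (file-private): `f = χ · θ` pointwise with `θ ∈ S` and `χ ≡ 1` puts `f` in `S`. [folklore] -/
private theorem mem_of_exists_eq_mul_of_eq_one_aux {P : Type*} {S : Submodule ℂ (P → ℂ)} {f χ : P → ℂ}
    (h : ∃ θ ∈ S, ∀ p, f p = χ p * θ p) (hχ : ∀ p, χ p = 1) : f ∈ S := by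
  obtain ⟨θ, hθ, hf⟩ := h
  have hfθ : f = θ := funext fun p => by rw [hf p, hχ p, one_mul]
  exact hfθ ▸ hθ

variable (F E : Type) [Field F] [NumberField F] [Field E] [NumberField E] [Algebra F E]
variable (c : E ≃ₐ[F] E) (N₁ N₂ M : ℕ) {n n₁ n₂ : ℕ}
  (eV : Fin (N₁ + N₂) × Fin M ≃ Fin n) (e₁ : Fin N₁ × Fin M ≃ Fin n₁) (e₂ : Fin N₂ × Fin M ≃ Fin n₂)
variable (J₁ : Matrix (Fin N₁) (Fin N₁) E) (J₂ : Matrix (Fin N₂) (Fin N₂) E) (JW : Matrix (Fin M) (Fin M) E)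
variable {T₁ : Matrix (Fin N₁) (Fin N₁) F} {T₂ : Matrix (Fin N₂) (Fin N₂) F} {TW : Matrix (Fin M) (Fin M) F}
variable [Algebra.IsQuadraticExtension F E] {δ : E} (hcδ : c δ = -δ) (hδ : δ ≠ 0) {d : F}
  (hd : δ * δ = algebraMap F E d) (h₁ : T₁.IsSymm) (h₂ : T₂.IsSymm) (hW : TW.IsSymm) (h₁d : IsUnit T₁.det)
  (h₂d : IsUnit T₂.det) (hWd : IsUnit TW.det) (hVd : IsUnit (finSum N₁ N₂ T₁ T₂).det)
  (hJ₁ : J₁ = T₁.map (algebraMap F E)) (hJ₂ : J₂ = T₂.map (algebraMap F E)) (hJW : JW = TW.map (algebraMap F E))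

variable {s : adelicPair F E c (N₁ + N₂) M (finSum N₁ N₂ J₁ J₂) JW →*
    adelicMpCont F (Fin n) (adelicGram F eV (finSum N₁ N₂ T₁ T₂) TW)}
  {s₁ : adelicPair F E c N₁ M J₁ JW →* adelicMpCont F (Fin n₁) (adelicGram F e₁ T₁ TW)}
  {s₂ : adelicPair F E c N₂ M J₂ JW →* adelicMpCont F (Fin n₂) (adelicGram F e₂ T₂ TW)}

/-- **[Liu2021]'s «claim» on the span of pure tensors, FUNCTION LEVEL** (proof of Thm. 4.15, l. 2199–2210, display l. 2204–2208):
for every test vector `Φ` in the `ℂ`-span of the pure tensors `sumTensor e_Σ Φ₁ Φ₂ = R_{e_Σ}⁻¹(Φ₁ ⊠ Φ₂)`, the theta function of the big pair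
restricted to the V-side see-saw group, `p = ((g₁,g₂),u) ↦ Θ(ω(s_pair(g₁ ⊕ᶠ g₂, u)) Φ)`, is `χ(p)` times a function in the `ℂ`-span of the
PRODUCTS `p ↦ Θ(ω(s_{1,pair}(g₁,u)) Φ₁) · Θ(ω(s_{2,pair}(g₂,u)) Φ₂)` («`θ_μ^φ(g⋆) = Σ_i (Σ_{v⋆^⊥} (ω φ⋆,i^⊥)(v⋆^⊥)) · θ_μ^{φ⋆,i}(g⋆)`»; `χ`
the automorphic see-saw character of §2, `= 1` on rational points).  Linearity of `ω(p)` and `Θ` over §3. [cite: Liu2021, proof of Thm. 4.15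
(FJcycle.tex l. 2199–2210)] [cite: Kudla1984, §1] -/
theorem exists_mem_span_thetaProd_of_mem_span_sumTensor
    (hs : (splittingDatum F E c (N₁ + N₂) M eV (finSum N₁ N₂ J₁ J₂) JW hcδ hδ hd (isSymm_finSum h₁ h₂) hW hVd hWd
      (finSum_eq_map_finSum F E N₁ N₂ J₁ J₂ hJ₁ hJ₂) hJW).IsCompatible s)
    (hs₁ : (splittingDatum F E c N₁ M e₁ J₁ JW hcδ hδ hd h₁ hW h₁d hWd hJ₁ hJW).IsCompatible s₁)
    (hs₂ : (splittingDatum F E c N₂ M e₂ J₂ JW hcδ hδ hd h₂ hW h₂d hWd hJ₂ hJW).IsCompatible s₂)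
    {Φ : piSchwartzBruhat F (Fin (N₁ + N₂) × Fin M)}
    (hΦ : Φ ∈ Submodule.span ℂ (Set.range fun ΦΦ : piSchwartzBruhat F (Fin N₁ × Fin M) × piSchwartzBruhat F (Fin N₂ × Fin M) =>
      sumTensor F ((finSumFinEquiv.prodCongr (Equiv.refl (Fin M))).symm.trans
        (Equiv.sumProdDistrib (Fin N₁) (Fin N₂) (Fin M))) ΦΦ.1 ΦΦ.2)) :
    ∃ θ ∈ Submodule.span ℂ (Set.range fun ΦΦ : piSchwartzBruhat F (Fin N₁ × Fin M) × piSchwartzBruhat F (Fin N₂ × Fin M) =>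
        fun p : (adelic F E c N₁ J₁ × adelic F E c N₂ J₂) × adelic F E c M JW =>
          thetaDistLM F (Fin N₁ × Fin M)
              (adelicMpCont.omega F (Fin N₁ × Fin M)
                (T₁.map (algebraMap F (AdeleRing (𝓞 F) F)) ⊗ₖ TW.map (algebraMap F (AdeleRing (𝓞 F) F)))
                (seesawSmallLeft₁ F E c N₁ N₂ M e₁ J₁ J₂ JW s₁ p) ΦΦ.1) *
            thetaDistLM F (Fin N₂ × Fin M)
              (adelicMpCont.omega F (Fin N₂ × Fin M)
                (T₂.map (algebraMap F (AdeleRing (𝓞 F) F)) ⊗ₖ TW.map (algebraMap F (AdeleRing (𝓞 F) F)))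
                (seesawSmallLeft₂ F E c N₁ N₂ M e₂ J₁ J₂ JW s₂ p) ΦΦ.2)),
      ∀ p : (adelic F E c N₁ J₁ × adelic F E c N₂ J₂) × adelic F E c M JW,
        thetaDistLM F (Fin (N₁ + N₂) × Fin M)
            (adelicMpCont.omega F (Fin (N₁ + N₂) × Fin M)
              ((finSum N₁ N₂ T₁ T₂).map (algebraMap F (AdeleRing (𝓞 F) F)) ⊗ₖ TW.map (algebraMap F (AdeleRing (𝓞 F) F)))
              (seesawBigLeft F E c N₁ N₂ M eV J₁ J₂ JW s p) Φ) =
          (mpSeesawCharLeft F E c N₁ N₂ M eV e₁ e₂ J₁ J₂ JW hcδ hδ hd h₁ h₂ hW h₁d h₂d hWd hVd hJ₁ hJ₂ hJW hs hs₁ hs₂ p : ℂ) *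
            θ p :=
  exists_mem_span_prod_of_mem_span_aux _
    (fun p => (thetaDistLM F (Fin (N₁ + N₂) × Fin M)).comp
      (adelicMpCont.omega F (Fin (N₁ + N₂) × Fin M)
        ((finSum N₁ N₂ T₁ T₂).map (algebraMap F (AdeleRing (𝓞 F) F)) ⊗ₖ TW.map (algebraMap F (AdeleRing (𝓞 F) F)))
        (seesawBigLeft F E c N₁ N₂ M eV J₁ J₂ JW s p)))
    _ _ _
    (fun Φ₁ Φ₂ p =>
      thetaDistLM_omega_seesawBigLeft_sumTensor F E c N₁ N₂ M eV e₁ e₂ J₁ J₂ JW hcδ hδ hd h₁ h₂ hW h₁d h₂d hWd hVd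
        hJ₁ hJ₂ hJW hs hs₁ hs₂ p Φ₁ Φ₂)
    hΦ

/-- **… and if the see-saw character is identically `1`** (the conclusion of the cell's S2c leaf: the small pair splittings re-chosen inside
their [GR91 3.1.1] compatibility class — `AdelicMetaplecticSeesawRenormalisation`), **the restricted theta function itself lies in the span of the
products** — [Liu2021]'s «the map induced by the inclusion `G⋆ ↪ G` sends `V(μ,e)` to `V⋆(μ,e)`» (l. 2199) at function level, the `V⋆^⊥`-factor kept.
[cite: Liu2021, proof of Thm. 4.15 (FJcycle.tex l. 2199–2210)] -/
theorem thetaFun_seesawBigLeft_mem_span_thetaProd_of_char_eq_one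
    (hs : (splittingDatum F E c (N₁ + N₂) M eV (finSum N₁ N₂ J₁ J₂) JW hcδ hδ hd (isSymm_finSum h₁ h₂) hW hVd hWd
      (finSum_eq_map_finSum F E N₁ N₂ J₁ J₂ hJ₁ hJ₂) hJW).IsCompatible s)
    (hs₁ : (splittingDatum F E c N₁ M e₁ J₁ JW hcδ hδ hd h₁ hW h₁d hWd hJ₁ hJW).IsCompatible s₁)
    (hs₂ : (splittingDatum F E c N₂ M e₂ J₂ JW hcδ hδ hd h₂ hW h₂d hWd hJ₂ hJW).IsCompatible s₂)
    (hχ : ∀ p, (mpSeesawCharLeft F E c N₁ N₂ M eV e₁ e₂ J₁ J₂ JW hcδ hδ hd h₁ h₂ hW h₁d h₂d hWd hVd hJ₁ hJ₂ hJW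
      hs hs₁ hs₂ p : ℂ) = 1)
    {Φ : piSchwartzBruhat F (Fin (N₁ + N₂) × Fin M)}
    (hΦ : Φ ∈ Submodule.span ℂ (Set.range fun ΦΦ : piSchwartzBruhat F (Fin N₁ × Fin M) × piSchwartzBruhat F (Fin N₂ × Fin M) =>
      sumTensor F ((finSumFinEquiv.prodCongr (Equiv.refl (Fin M))).symm.trans
        (Equiv.sumProdDistrib (Fin N₁) (Fin N₂) (Fin M))) ΦΦ.1 ΦΦ.2)) :
    (fun p : (adelic F E c N₁ J₁ × adelic F E c N₂ J₂) × adelic F E c M JW =>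
        thetaDistLM F (Fin (N₁ + N₂) × Fin M)
          (adelicMpCont.omega F (Fin (N₁ + N₂) × Fin M)
            ((finSum N₁ N₂ T₁ T₂).map (algebraMap F (AdeleRing (𝓞 F) F)) ⊗ₖ TW.map (algebraMap F (AdeleRing (𝓞 F) F)))
            (seesawBigLeft F E c N₁ N₂ M eV J₁ J₂ JW s p) Φ)) ∈
      Submodule.span ℂ (Set.range fun ΦΦ : piSchwartzBruhat F (Fin N₁ × Fin M) × piSchwartzBruhat F (Fin N₂ × Fin M) =>
        fun p : (adelic F E c N₁ J₁ × adelic F E c N₂ J₂) × adelic F E c M JW =>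
          thetaDistLM F (Fin N₁ × Fin M)
              (adelicMpCont.omega F (Fin N₁ × Fin M)
                (T₁.map (algebraMap F (AdeleRing (𝓞 F) F)) ⊗ₖ TW.map (algebraMap F (AdeleRing (𝓞 F) F)))
                (seesawSmallLeft₁ F E c N₁ N₂ M e₁ J₁ J₂ JW s₁ p) ΦΦ.1) *
            thetaDistLM F (Fin N₂ × Fin M)
              (adelicMpCont.omega F (Fin N₂ × Fin M)
                (T₂.map (algebraMap F (AdeleRing (𝓞 F) F)) ⊗ₖ TW.map (algebraMap F (AdeleRing (𝓞 F) F)))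
                (seesawSmallLeft₂ F E c N₁ N₂ M e₂ J₁ J₂ JW s₂ p) ΦΦ.2)) :=
  mem_of_exists_eq_mul_of_eq_one_aux
    (exists_mem_span_thetaProd_of_mem_span_sumTensor F E c N₁ N₂ M eV e₁ e₂ J₁ J₂ JW hcδ hδ hd h₁ h₂ hW h₁d h₂d hWd hVd
      hJ₁ hJ₂ hJW hs hs₁ hs₂ hΦ) hχ

end SpanAssembly

end UnitaryDualPair

end Literature.NumberTheory.GelbartRogawski1991

end
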